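/-
Copyright (c) 2026 the pub-hodgecm-mathlib formalisation cell (harness21).  Prover seat hodgecm-mathlib-F0P3a-p01 (g36), FLOOR 0, SUPPORTS-ONLY on h413; dealer LH4-plan (g13)
WORD #74 (1): owner of (T-box | lev) (b)+(c).  FILE 2 «LEV TILING».  2026-09-04.
-/
import Summits.HodgeConjecture.HodgeConjecture.Theorems.F0P3cDyRamKappaCountBoxSumTiling   -- ★ p14 FILE 3: `leaf_T`, `leaf_Z`, `leaf_TT`
import Summits.HodgeConjecture.HodgeConjecture.Theorems.F0P3cDyRamLevBoxSumArith         -- FILE 2a (this seat): the pure-ℕ letters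
import HarnessLib

/-!
# Crux `H413`, LH4 «(D-RAM) FOUR-FRAME» road, STAGE 1b — brick (T-box | lev) FILE 2b «LEV TILING, apex 0» — ED. 2 (proof-only: lint debt repaid, linter options removed, tolerant `simp` passes pruned; statements unchanged)

Cell `hodgecm-mathlib` (D-0151), crux item H413 = `stmt-HodgeConjecture-24833`, route of record `HCCMUnconditional`.  THEOREMS ONLY (pure `ℕ`∕`ℚ` bookkeeping; no lattices,
no `def`, no instance, no notation, no `sorry`, default heartbeats); lane `--supports stmt-HodgeConjecture-24833 --as helper` (count-neutral).  Twin of ★ `kappa_arith`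
(LH4-p14 (g3), `ℓ₁ = ℓ₂ = 0`) and ★ `kappa_arith_trunc` (LH4-p10 (g6), the row `(0, mstarOfRecord d)`), for the tables of ★ p860066∕p860094 `LevLabelledBoxSum(Wide) ℓ₁ ℓ₂`.

THE MATHEMATICS (memo `F0/P3a/F0P3a-p01/g36/tbox/TBOX-LEV-SPEC.v1.F0P3ap01g36.md` 7f362386 §4; closed forms certified by `tbox/evalcheck.py`, 50 148 ∕ 50 148).  After FILE 1
(`kappa_plane_sum_lev`, `kappa_diag_sum_lev`) and ★ `foot_mul_eval` ∕ ★ `window_mul_eval'`, `(x − 1)·Σ_{box}` of the two-token κ-table is a sum of evaluated blocks: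
per apex plane the FOOT block `[⌊N∕2⌋ + d ≤ ⌊(n−ℓ₁)∕2⌋]·ω·(x^{⌊(n−ℓ₁)∕2⌋+⌊N∕2⌋+1} − x^{2⌊N∕2⌋+d})`, `N = min(min(n′,n″), n_r − ℓ₁, 2n_r − ℓ₂)`, and the LOCUS window
`εG·[max(1,L) ≤ C]·(x^{A+C+1} − x^{A+max(1,L)})`, `A = 2⌊(n′−ℓ₁)∕2⌋ + s∕2`, `L = d − s∕2 ∣ d`, `C = min(n′−ℓ₁−M, ⌊(2n′−ℓ₂)∕2⌋−M, ⌊(2n′−d+1−ℓ₁)∕2⌋−M)`,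
`M = ⌊(n′−ℓ₁)∕2⌋`; plus the H window on an equilateral key.  THE IDENTITY: their total is `SIGN·(x^{k−X} − x^{k−max(X, B+y)})`, `2k + d = Σn + 2`,
`2B = (n_i + 2(d%2) + 2 − 3d)⁺`, `y = 2⌈(ℓ₁ − d%2)∕2⌉`, `X = max(ℓ₁, (⌊(ℓ₂+1)∕2⌋ − ⌊d∕2⌋)⁺ + y∕2)`: the `D₂` level truncates the TOP of ★ `kappa_arith`'s tiling
`[k−B, k−1]`, the `D₁` level truncates the top at `k − ℓ₁` and, per foot-parity step, OPENS TWO LAYERS BELOW the unit's bottom.  Rows of record: lo `(cs, 0)`,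
hi `(cs+1, 2)`, clean-lo `(sT, 0)`, clean-hi `(sT+1, 2)`.  MECHANISM of the proof: parities made explicit (`d = 2e+δ`, `n = 2a+δ`, …), slots by `fin_cases`, the
conductor side condition `εG p p = ω` when the apex excess is `≥ 2d`, every leaf an exponent identity closed by `omega` (which digests `min`, `max`, `∕2`).
* `kappa_arith_lev_apex0`, `kappa_arith_lev_apex1`, `kappa_arith_lev_apex2` (strictly isoceles keys), `kappa_arith_lev_equi` (equilateral), and the dispatch
  **`kappa_arith_lev`** — HEAD, hypotheses = ★ p860094 `LevLabelledBoxSumWide`'s arithmetic ones.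

HONEST LABEL: arithmetic helper toward `levLabelledBoxSumWide_holds` (FILE 3); pays no tier-0 row; the four (L-lev) law stubs and their `hTrunk` binders stay OPEN; HC_CM is
proved only modulo the 7 printed citations (2 remaining named inputs: hLiu418 = `stmt-HodgeConjecture-24832`, h413 = `stmt-HodgeConjecture-24833`) until rung 0 closes.

## References
* [Kottwitz1986BaseChangeUnits] R. E. Kottwitz, *Base change for unit elements of Hecke algebras*, Compositio Math. 60 (1986), §1 pp. 240–241.
* [Rogawski1990] J. D. Rogawski, *Automorphic Representations of Unitary Groups in Three Variables*, Ann. of Math. Stud. 123 (1990), §4.9 Prop. 4.9.1 (a) p. 55; §4.10 p. 58.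
-/

set_option autoImplicit false

namespace Summit.HodgeConjecture.HodgeConjecture.Cruxes.H413.F0P3cDyRamLevBoxSumTiling

open Finset
open Summit.HodgeConjecture.HodgeConjecture.Cruxes.H413.F0P3cDyRamKappaCountBoxSumTiling (leaf_T leaf_Z leaf_TT)
open Summit.HodgeConjecture.HodgeConjecture.Cruxes.H413.F0P3cDyRamLevBoxSumArith

section Tools

/-- Linearisation of a three-way `min` for `omega` (which must not see `min`). [folklore] -/
theorem min3_linear (p q r : ℕ) :
    (min p (min q r) = p ∧ p ≤ q ∧ p ≤ r) ∨ (min p (min q r) = q ∧ q ≤ p ∧ q ≤ r) ∨ (min p (min q r) = r ∧ r ≤ p ∧ r ≤ q) := by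
  rcases le_total p (min q r) with h | h
  · rw [min_eq_left h]; exact Or.inl ⟨rfl, (le_min_iff.1 h).1, (le_min_iff.1 h).2⟩
  · rw [min_eq_right h]
    rcases le_total q r with h' | h'
    · rw [min_eq_left h'] at h ⊢; exact Or.inr (Or.inl ⟨rfl, h, h'⟩)
    · rw [min_eq_right h'] at h ⊢; exact Or.inr (Or.inr ⟨rfl, h, h'⟩)

/-- Linearisation of a `max` for `omega`. [folklore] -/
theorem max_linear (p q : ℕ) : (max p q = p ∧ q ≤ p) ∨ (max p q = q ∧ p ≤ q) := by
  rcases le_total q p with h | h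
  · exact Or.inl ⟨max_eq_left h, h⟩
  · exact Or.inr ⟨max_eq_right h, h⟩

end Tools

/-- The lev tiling, strict apex `0` (glue legs `n₂`, apex `n₁`), slot `0`. [folklore] -/
theorem kappa_arith_lev_apex0_slot0 (x ω εH : ℚ) (εG : Fin 3 → Fin 3 → ℚ) {d n₂ n₁ k ℓ₁ ℓ₂ : ℕ} (hd : 2 ≤ d) (hlt : n₂ < n₁)
    (hl : n₂ % 2 = d % 2) (ha : n₁ % 2 = d % 2) (hk : 2 * k + d = n₁ + n₂ + n₂ + 2) (hfg : 2 * d ≤ n₂ + 1) (hfa : 2 * d ≤ n₁ + 1)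
    (hℓ₁ : ℓ₁ ≤ 2) (hℓ₂ : ℓ₂ ≤ n₂ + ℓ₁) (hcorner : d % 2 = 0 → ℓ₁ = 1 → d + 1 ≤ ℓ₂) (i : Fin 3) (hi : i = 0) (hω : n₂ + 2 * d ≤ n₁ → εG 0 0 = ω) :
    (if n₁ = n₂ ∧ n₂ = n₂ then εH * (if max 1 d ≤ min (n₁ - ℓ₁ - (n₁ - ℓ₁) / 2) (min ((2 * n₁ - ℓ₂) / 2 - (n₁ - ℓ₁) / 2) ((2 * n₁ - d + 1 - ℓ₁) / 2 - (n₁ - ℓ₁) / 2)) then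
          x ^ (2 * ((n₁ - ℓ₁) / 2) + min (n₁ - ℓ₁ - (n₁ - ℓ₁) / 2) (min ((2 * n₁ - ℓ₂) / 2 - (n₁ - ℓ₁) / 2) ((2 * n₁ - d + 1 - ℓ₁) / 2 - (n₁ - ℓ₁) / 2)) + 1) - x ^ (2 * ((n₁ - ℓ₁) / 2) + max 1 d) else 0) else 0) +
        ((if i = 0 then (if min (min n₂ n₂) (min (n₂ - ℓ₁) (2 * n₂ - ℓ₂)) / 2 + d ≤ (n₁ - ℓ₁) / 2 then
            ω * (x ^ ((n₁ - ℓ₁) / 2 + min (min n₂ n₂) (min (n₂ - ℓ₁) (2 * n₂ - ℓ₂)) / 2 + 1) - x ^ (2 * (min (min n₂ n₂) (min (n₂ - ℓ₁) (2 * n₂ - ℓ₂)) / 2) + d)) else 0) else 0) +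
          (if n₂ = n₂ ∧ n₂ < n₁ ∧ (n₁ - n₂) % 2 = 0 then εG 0 i *
            (if max 1 (if i = 0 then d - (n₁ - n₂) / 2 else d) ≤ min (n₂ - ℓ₁ - (n₂ - ℓ₁) / 2) (min ((2 * n₂ - ℓ₂) / 2 - (n₂ - ℓ₁) / 2) ((2 * n₂ - d + 1 - ℓ₁) / 2 - (n₂ - ℓ₁) / 2)) then
              x ^ (2 * ((n₂ - ℓ₁) / 2) + (n₁ - n₂) / 2 + min (n₂ - ℓ₁ - (n₂ - ℓ₁) / 2) (min ((2 * n₂ - ℓ₂) / 2 - (n₂ - ℓ₁) / 2) ((2 * n₂ - d + 1 - ℓ₁) / 2 - (n₂ - ℓ₁) / 2)) + 1) -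
                x ^ (2 * ((n₂ - ℓ₁) / 2) + (n₁ - n₂) / 2 + max 1 (if i = 0 then d - (n₁ - n₂) / 2 else d)) else 0) else 0)) +
        ((if i = 1 then (if min (min n₁ n₂) (min (n₁ - ℓ₁) (2 * n₁ - ℓ₂)) / 2 + d ≤ (n₂ - ℓ₁) / 2 then
            ω * (x ^ ((n₂ - ℓ₁) / 2 + min (min n₁ n₂) (min (n₁ - ℓ₁) (2 * n₁ - ℓ₂)) / 2 + 1) - x ^ (2 * (min (min n₁ n₂) (min (n₁ - ℓ₁) (2 * n₁ - ℓ₂)) / 2) + d)) else 0) else 0) +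
          (if n₁ = n₂ ∧ n₁ < n₂ ∧ (n₂ - n₁) % 2 = 0 then εG 1 i *
            (if max 1 (if i = 1 then d - (n₂ - n₁) / 2 else d) ≤ min (n₁ - ℓ₁ - (n₁ - ℓ₁) / 2) (min ((2 * n₁ - ℓ₂) / 2 - (n₁ - ℓ₁) / 2) ((2 * n₁ - d + 1 - ℓ₁) / 2 - (n₁ - ℓ₁) / 2)) then
              x ^ (2 * ((n₁ - ℓ₁) / 2) + (n₂ - n₁) / 2 + min (n₁ - ℓ₁ - (n₁ - ℓ₁) / 2) (min ((2 * n₁ - ℓ₂) / 2 - (n₁ - ℓ₁) / 2) ((2 * n₁ - d + 1 - ℓ₁) / 2 - (n₁ - ℓ₁) / 2)) + 1) -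
                x ^ (2 * ((n₁ - ℓ₁) / 2) + (n₂ - n₁) / 2 + max 1 (if i = 1 then d - (n₂ - n₁) / 2 else d)) else 0) else 0)) +
        ((if i = 2 then (if min (min n₁ n₂) (min (n₂ - ℓ₁) (2 * n₂ - ℓ₂)) / 2 + d ≤ (n₂ - ℓ₁) / 2 then
            ω * (x ^ ((n₂ - ℓ₁) / 2 + min (min n₁ n₂) (min (n₂ - ℓ₁) (2 * n₂ - ℓ₂)) / 2 + 1) - x ^ (2 * (min (min n₁ n₂) (min (n₂ - ℓ₁) (2 * n₂ - ℓ₂)) / 2) + d)) else 0) else 0) +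
          (if n₁ = n₂ ∧ n₁ < n₂ ∧ (n₂ - n₁) % 2 = 0 then εG 2 i *
            (if max 1 (if i = 2 then d - (n₂ - n₁) / 2 else d) ≤ min (n₁ - ℓ₁ - (n₁ - ℓ₁) / 2) (min ((2 * n₁ - ℓ₂) / 2 - (n₁ - ℓ₁) / 2) ((2 * n₁ - d + 1 - ℓ₁) / 2 - (n₁ - ℓ₁) / 2)) then
              x ^ (2 * ((n₁ - ℓ₁) / 2) + (n₂ - n₁) / 2 + min (n₁ - ℓ₁ - (n₁ - ℓ₁) / 2) (min ((2 * n₁ - ℓ₂) / 2 - (n₁ - ℓ₁) / 2) ((2 * n₁ - d + 1 - ℓ₁) / 2 - (n₁ - ℓ₁) / 2)) + 1) -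
                x ^ (2 * ((n₁ - ℓ₁) / 2) + (n₂ - n₁) / 2 + max 1 (if i = 2 then d - (n₂ - n₁) / 2 else d)) else 0) else 0))
      = (if n₁ = n₂ ∧ n₂ = n₂ then εH else if n₂ = n₂ then εG 0 i else if n₁ = n₂ then εG 1 i else εG 2 i) *
        (x ^ (k - max ℓ₁ ((ℓ₂ + 1) / 2 - d / 2 + (ℓ₁ + 1 - d % 2) / 2)) -
          x ^ (k - max (max ℓ₁ ((ℓ₂ + 1) / 2 - d / 2 + (ℓ₁ + 1 - d % 2) / 2))
            ((((![n₁, n₂, n₂] : Fin 3 → ℕ) i + 2 * (d % 2) + 2 - 3 * d) / 2) + 2 * ((ℓ₁ + 1 - d % 2) / 2)))) := by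
  subst hi
  obtain ⟨δ, e, hδ, rfl⟩ : ∃ δ e, δ ≤ 1 ∧ d = 2 * e + δ := ⟨d % 2, d / 2, by omega, by omega⟩
  obtain ⟨a, rfl⟩ : ∃ a, n₂ = 2 * a + δ := ⟨n₂ / 2, by omega⟩
  obtain ⟨t, ht, rfl⟩ : ∃ t, 1 ≤ t ∧ n₁ = 2 * (a + t) + δ := ⟨n₁ / 2 - a, by omega, by omega⟩
  obtain ⟨t₁, ht₁⟩ : ∃ t₁, 2 * a + δ = t₁ + ℓ₁ := ⟨2 * a + δ - ℓ₁, by omega⟩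
  obtain ⟨t₂, ht₂⟩ : ∃ t₂, 2 * (2 * a + δ) = t₂ + ℓ₂ := ⟨2 * (2 * a + δ) - ℓ₂, by omega⟩
  obtain ⟨t₃, ht₃⟩ : ∃ t₃, 2 * (2 * a + δ) + 1 = t₃ + (2 * e + δ) + ℓ₁ := ⟨2 * (2 * a + δ) + 1 - (2 * e + δ) - ℓ₁, by omega⟩
  obtain ⟨M, μ, hμ, hM⟩ : ∃ M μ, μ ≤ 1 ∧ t₁ = 2 * M + μ := ⟨t₁ / 2, t₁ % 2, by omega, by omega⟩
  obtain ⟨W, ν, hν, hW⟩ : ∃ W ν, ν ≤ 1 ∧ t₂ = 2 * W + ν := ⟨t₂ / 2, t₂ % 2, by omega, by omega⟩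
  obtain ⟨V, κ, hκ, hV⟩ : ∃ V κ, κ ≤ 1 ∧ t₃ = 2 * V + κ := ⟨t₃ / 2, t₃ % 2, by omega, by omega⟩
  obtain ⟨Gh, γ, hγ, hGh⟩ : ∃ Gh γ, γ ≤ 1 ∧ ℓ₂ + 1 = 2 * Gh + γ := ⟨(ℓ₂ + 1) / 2, (ℓ₂ + 1) % 2, by omega, by omega⟩
  obtain ⟨Yh, ψ, hψ, hYh⟩ : ∃ Yh ψ, ψ ≤ 1 ∧ ℓ₁ + 1 = 2 * Yh + ψ + δ := ⟨(ℓ₁ + 1 - δ) / 2, (ℓ₁ + 1 - δ) % 2, by omega, by omega⟩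
  obtain ⟨r9, r10, r11⟩ : (2 * a + δ - ℓ₁ = t₁) ∧ (2 * (2 * a + δ) - ℓ₂ = t₂) ∧ (2 * (2 * a + δ) - (2 * e + δ) + 1 - ℓ₁ = t₃) :=
    ⟨by clear * - hδ hd ht hℓ₁ hℓ₂ hfg ht₁ ht₂ ht₃; omega, by clear * - hδ hd ht hℓ₁ hℓ₂ hfg ht₁ ht₂ ht₃; omega, by clear * - hδ hd ht hℓ₁ hℓ₂ hfg ht₁ ht₂ ht₃; omega⟩
  obtain ⟨r12, r16, r13⟩ : (2 * (a + t) + δ - ℓ₁ = t₁ + 2 * t) ∧ (2 * (2 * (a + t) + δ) - ℓ₂ = t₂ + 4 * t) ∧ (t₁ / 2 = M) :=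
    ⟨by clear * - hδ hd ht hℓ₁ hℓ₂ hfg ht₁ ht₂ ht₃; omega, by clear * - hδ hd ht hℓ₁ hℓ₂ hfg ht₁ ht₂ ht₃; omega, by clear * - hμ hM; omega⟩
  obtain ⟨r14, r15, r17⟩ : ((t₁ + 2 * t) / 2 = M + t) ∧ (t₁ - M = M + μ) ∧ (t₂ / 2 = W) := ⟨by clear * - hμ hM; omega, by clear * - hμ hM; omega, by clear * - hν hW; omega⟩
  obtain ⟨r18, r19, r20⟩ : (t₃ / 2 = V) ∧ ((ℓ₂ + 1) / 2 = Gh) ∧ ((ℓ₁ + 1 - δ) / 2 = Yh) := ⟨by clear * - hκ hV; omega, by clear * - hγ hGh; omega, by clear * - hψ hYh hδ; omega⟩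
  obtain ⟨r21, r1, r2⟩ : ((2 * a + δ) / 2 = a) ∧ ((2 * e + δ) % 2 = δ) ∧ ((2 * e + δ) / 2 = e) := ⟨by clear * - hδ; omega, by clear * - hδ; omega, by clear * - hδ; omega⟩
  obtain ⟨r5, hne0, hne1⟩ : ((2 * (a + t) + δ - (2 * a + δ)) / 2 = t) ∧ (¬ (2 * (a + t) + δ = 2 * a + δ)) ∧ (¬ (2 * a + δ = 2 * (a + t) + δ)) :=
    ⟨by clear * - hδ; omega, by clear * - ht; omega, by clear * - ht; omega⟩
  obtain ⟨hlt', hnlt, hpar⟩ : (2 * a + δ < 2 * (a + t) + δ) ∧ (¬ (2 * (a + t) + δ < 2 * a + δ)) ∧ ((2 * (a + t) + δ - (2 * a + δ)) % 2 = 0) :=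
    ⟨by clear * - ht; omega, by clear * - ht; omega, by clear * - ht; omega⟩
  obtain ⟨r7, r8, rN0⟩ : ((2 * a + δ + 2 * δ + 2 - 3 * (2 * e + δ)) / 2 = a + 1 - 3 * e) ∧ ((2 * (a + t) + δ + 2 * δ + 2 - 3 * (2 * e + δ)) / 2 = a + t + 1 - 3 * e) ∧ (min (min (2 * a + δ) (2 * a + δ)) (min t₁ t₂) = t₁) :=
    ⟨by clear * - hδ; omega, by clear * - hδ; omega, by clear * - hδ hd ht hℓ₁ hℓ₂ hfg ht₁ ht₂ ht₃; omega⟩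
  obtain ⟨rN1, rN2⟩ : (min (min (2 * (a + t) + δ) (2 * a + δ)) (min (t₁ + 2 * t) (t₂ + 4 * t)) = 2 * a + δ) ∧ (min (min (2 * (a + t) + δ) (2 * a + δ)) (min t₁ t₂) = t₁) :=
    ⟨by clear * - hδ hd ht hℓ₁ hℓ₂ hfg ht₁ ht₂ ht₃; omega, by clear * - hδ hd ht hℓ₁ hℓ₂ hfg ht₁ ht₂ ht₃; omega⟩
  (try simp only [hne0]); (try simp only [hlt']); (try simp only [hnlt]); (try simp only [hpar])
  (try simp only [false_and]); (try simp only [and_self])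
  (try simp only [↓reduceIte]); (try simp only [Fin.isValue, Fin.reduceEq]); (try simp only [↓reduceIte]); (try simp only [zero_add]); (try simp only [add_zero]); (try simp only [r1])
  (try simp only [r2]); (try simp only [r5])
  (try simp only [Matrix.cons_val_zero]); (try simp only [r8]); (try simp only [r9]); (try simp only [r10])
  (try simp only [r11]); (try simp only [r12]); (try simp only [r19]); (try simp only [r20]); (try simp only [rN0])
  (try simp only [r13]); (try simp only [r14]); (try simp only [r15]); (try simp only [r17])
  (try simp only [r18])
  clear r1 r2 r5 r7 r8 r9 r10 r11 r12 r13 r14 r15 r16 r17 r18 r19 r20 r21 rN0 rN1 rN2 hne0 hne1 hlt' hnlt hpar hl ha hlt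
  have hk' : k + e = 3 * a + t + δ + 1 := by clear * - hk; omega
  clear hk
  obtain ⟨cW, rfl⟩ : ∃ cW, W = M + cW := ⟨W - M, by clear * - hδ ht hℓ₁ hℓ₂ ht₁ ht₂ hμ hM hν hW; omega⟩
  obtain ⟨cV, rfl⟩ : ∃ cV, V = M + cV := ⟨V - M, by clear * - hδ hd ht hℓ₁ hfg ht₁ ht₃ hμ hM hκ hV; omega⟩
  simp only [Nat.add_sub_cancel_left]
  obtain ⟨hM', hcW, hcV⟩ : (2 * M + μ + ℓ₁ = 2 * a + δ) ∧ (cW + Gh = M + μ + ℓ₁) ∧ (cV + e = a + μ) :=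
    ⟨by clear * - hM ht₁; omega, by clear * - hM ht₁ hW ht₂ hGh hν hγ hℓ₂; omega, by clear * - hM ht₁ hV ht₃ hκ hμ hδ hfg; omega⟩
  have hYh' : 2 * Yh + δ = ℓ₁ + μ := by clear * - hM ht₁ hYh hψ hμ hδ hℓ₁; omega
  clear ht₁ ht₂ ht₃ hM hW hV hYh hν hκ hψ
  generalize hC : min (M + μ) (min cW cV) = C
  have hC3 := min3_linear (M + μ) cW cV
  rw [hC] at hC3
  obtain ⟨x₂, hx₂, hx₂eq⟩ : ∃ x₂ : ℕ, ((e ≤ Gh ∧ Gh = e + x₂) ∨ (Gh < e ∧ x₂ = 0)) ∧ Gh - e = x₂ := by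
    by_cases hGe : e ≤ Gh
    · exact ⟨Gh - e, Or.inl ⟨hGe, by omega⟩, rfl⟩
    · exact ⟨0, Or.inr ⟨by omega, rfl⟩, by omega⟩
  rw [hx₂eq]
  generalize hX : max ℓ₁ (x₂ + Yh) = X
  have hX2 := max_linear ℓ₁ (x₂ + Yh)
  rw [hX] at hX2
  clear hC hX hx₂eq
  obtain ⟨Bq, hB, hBeq⟩ : ∃ Bq : ℕ, ((3 * e ≤ a + t + 1 ∧ Bq + 3 * e = a + t + 1) ∨ (a + t + 1 < 3 * e ∧ Bq = 0)) ∧ a + t + 1 - 3 * e = Bq := by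
    by_cases h3 : 3 * e ≤ a + t + 1
    · exact ⟨a + t + 1 - 3 * e, Or.inl ⟨h3, by omega⟩, rfl⟩
    · exact ⟨0, Or.inr ⟨by omega, rfl⟩, by omega⟩
  rw [hBeq]
  clear hBeq
  generalize hP : max X (Bq + 2 * Yh) = P
  have hP2 := max_linear X (Bq + 2 * Yh)
  rw [hP] at hP2
  clear hP
  by_cases hdeep : 2 * a + δ + 2 * (2 * e + δ) ≤ 2 * (a + t) + δ
  · have htube : M + (2 * e + δ) ≤ M + t := by clear * - hdeep; omega
    have hL0 : 2 * e + δ - t = 0 := by clear * - hdeep; omega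
    rw [if_pos htube, hω hdeep, hL0, (by norm_num : max 1 0 = 1)]
    have hS2 := lev_arith_deep_bot _ _ _ _ _ _ _ _ _ _ _ _ hδ hℓ₁ hμ hM' hcW hcV hYh' hk' _ hx₂ _ hX2 _ hB _ hP2 hdeep
    by_cases hwin : 1 ≤ C
    · rw [if_pos hwin]
      exact leaf_TT (by have h := lev_arith_top _ _ _ _ _ _ _ _ _ _ _ _ hδ hd hℓ₁ hμ hM' hcW hcV hYh' hk' _ hC3 _ hx₂ _ hX2; clear * - h; omega) (by clear * - hwin; omega) (by clear * - hS2; omega)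
    · rw [if_neg hwin, mul_zero, add_zero]
      exact leaf_T (by have h := lev_arith_deep_top _ _ _ _ _ _ _ _ _ _ _ _ hδ hd hℓ₁ hfg hμ hM' hcW hcV hYh' hk' _ hC3 _ hx₂ _ hX2 hwin; clear * - h; omega) (by clear * - hS2; omega)
  · have htube : ¬ (M + (2 * e + δ) ≤ M + t) := by clear * - hdeep; omega
    obtain ⟨Lq, hLdef⟩ : ∃ Lq, 2 * e + δ = t + Lq := ⟨2 * e + δ - t, by clear * - hdeep; omega⟩
    have hLq : 1 ≤ Lq := by clear * - hdeep hLdef; omega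
    have hLeq : max 1 (2 * e + δ - t) = Lq := by clear * - hLdef hLq; omega
    rw [if_neg htube, zero_add, hLeq]
    by_cases hwin : Lq ≤ C
    · rw [if_pos hwin]
      exact leaf_T (by have h := lev_arith_top _ _ _ _ _ _ _ _ _ _ _ _ hδ hd hℓ₁ hμ hM' hcW hcV hYh' hk' _ hC3 _ hx₂ _ hX2; clear * - h; omega)
        (by have h := lev_arith_shallow_bot _ _ _ _ _ _ _ _ _ _ _ _ hδ hℓ₁ hμ hM' hcW hcV hYh' hk' _ hC3 _ hx₂ _ hX2 _ hB _ hP2 _ hLdef hwin; clear * - h hLdef; omega)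
    · rw [if_neg hwin, mul_zero]
      exact leaf_Z (by have h := lev_arith_shallow_empty _ _ _ _ _ _ _ _ _ _ _ _ _ _ hδ hℓ₁ hcorner hfg hμ hM' hcW hcV hγ hGh hYh' hk' _ hC3 _ hx₂ _ hX2 _ hB _ hP2 ht _ hLdef hwin; clear * - h; omega)

/-- The lev tiling, strict apex `0` (glue legs `n₂`, apex `n₁`), slot `1`. [folklore] -/
theorem kappa_arith_lev_apex0_slot1 (x ω εH : ℚ) (εG : Fin 3 → Fin 3 → ℚ) {d n₂ n₁ k ℓ₁ ℓ₂ : ℕ} (hd : 2 ≤ d) (hlt : n₂ < n₁)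
    (hl : n₂ % 2 = d % 2) (ha : n₁ % 2 = d % 2) (hk : 2 * k + d = n₁ + n₂ + n₂ + 2) (hfg : 2 * d ≤ n₂ + 1) (hfa : 2 * d ≤ n₁ + 1)
    (hℓ₁ : ℓ₁ ≤ 2) (hℓ₂ : ℓ₂ ≤ n₂ + ℓ₁) (hcorner : d % 2 = 0 → ℓ₁ = 1 → d + 1 ≤ ℓ₂) (i : Fin 3) (hi : i = 1) :
    (if n₁ = n₂ ∧ n₂ = n₂ then εH * (if max 1 d ≤ min (n₁ - ℓ₁ - (n₁ - ℓ₁) / 2) (min ((2 * n₁ - ℓ₂) / 2 - (n₁ - ℓ₁) / 2) ((2 * n₁ - d + 1 - ℓ₁) / 2 - (n₁ - ℓ₁) / 2)) then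
          x ^ (2 * ((n₁ - ℓ₁) / 2) + min (n₁ - ℓ₁ - (n₁ - ℓ₁) / 2) (min ((2 * n₁ - ℓ₂) / 2 - (n₁ - ℓ₁) / 2) ((2 * n₁ - d + 1 - ℓ₁) / 2 - (n₁ - ℓ₁) / 2)) + 1) - x ^ (2 * ((n₁ - ℓ₁) / 2) + max 1 d) else 0) else 0) +
        ((if i = 0 then (if min (min n₂ n₂) (min (n₂ - ℓ₁) (2 * n₂ - ℓ₂)) / 2 + d ≤ (n₁ - ℓ₁) / 2 then
            ω * (x ^ ((n₁ - ℓ₁) / 2 + min (min n₂ n₂) (min (n₂ - ℓ₁) (2 * n₂ - ℓ₂)) / 2 + 1) - x ^ (2 * (min (min n₂ n₂) (min (n₂ - ℓ₁) (2 * n₂ - ℓ₂)) / 2) + d)) else 0) else 0) +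
          (if n₂ = n₂ ∧ n₂ < n₁ ∧ (n₁ - n₂) % 2 = 0 then εG 0 i *
            (if max 1 (if i = 0 then d - (n₁ - n₂) / 2 else d) ≤ min (n₂ - ℓ₁ - (n₂ - ℓ₁) / 2) (min ((2 * n₂ - ℓ₂) / 2 - (n₂ - ℓ₁) / 2) ((2 * n₂ - d + 1 - ℓ₁) / 2 - (n₂ - ℓ₁) / 2)) then
              x ^ (2 * ((n₂ - ℓ₁) / 2) + (n₁ - n₂) / 2 + min (n₂ - ℓ₁ - (n₂ - ℓ₁) / 2) (min ((2 * n₂ - ℓ₂) / 2 - (n₂ - ℓ₁) / 2) ((2 * n₂ - d + 1 - ℓ₁) / 2 - (n₂ - ℓ₁) / 2)) + 1) -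
                x ^ (2 * ((n₂ - ℓ₁) / 2) + (n₁ - n₂) / 2 + max 1 (if i = 0 then d - (n₁ - n₂) / 2 else d)) else 0) else 0)) +
        ((if i = 1 then (if min (min n₁ n₂) (min (n₁ - ℓ₁) (2 * n₁ - ℓ₂)) / 2 + d ≤ (n₂ - ℓ₁) / 2 then
            ω * (x ^ ((n₂ - ℓ₁) / 2 + min (min n₁ n₂) (min (n₁ - ℓ₁) (2 * n₁ - ℓ₂)) / 2 + 1) - x ^ (2 * (min (min n₁ n₂) (min (n₁ - ℓ₁) (2 * n₁ - ℓ₂)) / 2) + d)) else 0) else 0) +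
          (if n₁ = n₂ ∧ n₁ < n₂ ∧ (n₂ - n₁) % 2 = 0 then εG 1 i *
            (if max 1 (if i = 1 then d - (n₂ - n₁) / 2 else d) ≤ min (n₁ - ℓ₁ - (n₁ - ℓ₁) / 2) (min ((2 * n₁ - ℓ₂) / 2 - (n₁ - ℓ₁) / 2) ((2 * n₁ - d + 1 - ℓ₁) / 2 - (n₁ - ℓ₁) / 2)) then
              x ^ (2 * ((n₁ - ℓ₁) / 2) + (n₂ - n₁) / 2 + min (n₁ - ℓ₁ - (n₁ - ℓ₁) / 2) (min ((2 * n₁ - ℓ₂) / 2 - (n₁ - ℓ₁) / 2) ((2 * n₁ - d + 1 - ℓ₁) / 2 - (n₁ - ℓ₁) / 2)) + 1) -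
                x ^ (2 * ((n₁ - ℓ₁) / 2) + (n₂ - n₁) / 2 + max 1 (if i = 1 then d - (n₂ - n₁) / 2 else d)) else 0) else 0)) +
        ((if i = 2 then (if min (min n₁ n₂) (min (n₂ - ℓ₁) (2 * n₂ - ℓ₂)) / 2 + d ≤ (n₂ - ℓ₁) / 2 then
            ω * (x ^ ((n₂ - ℓ₁) / 2 + min (min n₁ n₂) (min (n₂ - ℓ₁) (2 * n₂ - ℓ₂)) / 2 + 1) - x ^ (2 * (min (min n₁ n₂) (min (n₂ - ℓ₁) (2 * n₂ - ℓ₂)) / 2) + d)) else 0) else 0) +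
          (if n₁ = n₂ ∧ n₁ < n₂ ∧ (n₂ - n₁) % 2 = 0 then εG 2 i *
            (if max 1 (if i = 2 then d - (n₂ - n₁) / 2 else d) ≤ min (n₁ - ℓ₁ - (n₁ - ℓ₁) / 2) (min ((2 * n₁ - ℓ₂) / 2 - (n₁ - ℓ₁) / 2) ((2 * n₁ - d + 1 - ℓ₁) / 2 - (n₁ - ℓ₁) / 2)) then
              x ^ (2 * ((n₁ - ℓ₁) / 2) + (n₂ - n₁) / 2 + min (n₁ - ℓ₁ - (n₁ - ℓ₁) / 2) (min ((2 * n₁ - ℓ₂) / 2 - (n₁ - ℓ₁) / 2) ((2 * n₁ - d + 1 - ℓ₁) / 2 - (n₁ - ℓ₁) / 2)) + 1) -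
                x ^ (2 * ((n₁ - ℓ₁) / 2) + (n₂ - n₁) / 2 + max 1 (if i = 2 then d - (n₂ - n₁) / 2 else d)) else 0) else 0))
      = (if n₁ = n₂ ∧ n₂ = n₂ then εH else if n₂ = n₂ then εG 0 i else if n₁ = n₂ then εG 1 i else εG 2 i) *
        (x ^ (k - max ℓ₁ ((ℓ₂ + 1) / 2 - d / 2 + (ℓ₁ + 1 - d % 2) / 2)) -
          x ^ (k - max (max ℓ₁ ((ℓ₂ + 1) / 2 - d / 2 + (ℓ₁ + 1 - d % 2) / 2))
            ((((![n₁, n₂, n₂] : Fin 3 → ℕ) i + 2 * (d % 2) + 2 - 3 * d) / 2) + 2 * ((ℓ₁ + 1 - d % 2) / 2)))) := by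
  subst hi
  obtain ⟨δ, e, hδ, rfl⟩ : ∃ δ e, δ ≤ 1 ∧ d = 2 * e + δ := ⟨d % 2, d / 2, by omega, by omega⟩
  obtain ⟨a, rfl⟩ : ∃ a, n₂ = 2 * a + δ := ⟨n₂ / 2, by omega⟩
  obtain ⟨t, ht, rfl⟩ : ∃ t, 1 ≤ t ∧ n₁ = 2 * (a + t) + δ := ⟨n₁ / 2 - a, by omega, by omega⟩
  obtain ⟨t₁, ht₁⟩ : ∃ t₁, 2 * a + δ = t₁ + ℓ₁ := ⟨2 * a + δ - ℓ₁, by omega⟩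
  obtain ⟨t₂, ht₂⟩ : ∃ t₂, 2 * (2 * a + δ) = t₂ + ℓ₂ := ⟨2 * (2 * a + δ) - ℓ₂, by omega⟩
  obtain ⟨t₃, ht₃⟩ : ∃ t₃, 2 * (2 * a + δ) + 1 = t₃ + (2 * e + δ) + ℓ₁ := ⟨2 * (2 * a + δ) + 1 - (2 * e + δ) - ℓ₁, by omega⟩
  obtain ⟨M, μ, hμ, hM⟩ : ∃ M μ, μ ≤ 1 ∧ t₁ = 2 * M + μ := ⟨t₁ / 2, t₁ % 2, by omega, by omega⟩
  obtain ⟨W, ν, hν, hW⟩ : ∃ W ν, ν ≤ 1 ∧ t₂ = 2 * W + ν := ⟨t₂ / 2, t₂ % 2, by omega, by omega⟩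
  obtain ⟨V, κ, hκ, hV⟩ : ∃ V κ, κ ≤ 1 ∧ t₃ = 2 * V + κ := ⟨t₃ / 2, t₃ % 2, by omega, by omega⟩
  obtain ⟨Gh, γ, hγ, hGh⟩ : ∃ Gh γ, γ ≤ 1 ∧ ℓ₂ + 1 = 2 * Gh + γ := ⟨(ℓ₂ + 1) / 2, (ℓ₂ + 1) % 2, by omega, by omega⟩
  obtain ⟨Yh, ψ, hψ, hYh⟩ : ∃ Yh ψ, ψ ≤ 1 ∧ ℓ₁ + 1 = 2 * Yh + ψ + δ := ⟨(ℓ₁ + 1 - δ) / 2, (ℓ₁ + 1 - δ) % 2, by omega, by omega⟩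
  obtain ⟨r9, r10, r11⟩ : (2 * a + δ - ℓ₁ = t₁) ∧ (2 * (2 * a + δ) - ℓ₂ = t₂) ∧ (2 * (2 * a + δ) - (2 * e + δ) + 1 - ℓ₁ = t₃) :=
    ⟨by clear * - hδ hd ht hℓ₁ hℓ₂ hfg ht₁ ht₂ ht₃; omega, by clear * - hδ hd ht hℓ₁ hℓ₂ hfg ht₁ ht₂ ht₃; omega, by clear * - hδ hd ht hℓ₁ hℓ₂ hfg ht₁ ht₂ ht₃; omega⟩
  obtain ⟨r12, r16, r13⟩ : (2 * (a + t) + δ - ℓ₁ = t₁ + 2 * t) ∧ (2 * (2 * (a + t) + δ) - ℓ₂ = t₂ + 4 * t) ∧ (t₁ / 2 = M) :=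
    ⟨by clear * - hδ hd ht hℓ₁ hℓ₂ hfg ht₁ ht₂ ht₃; omega, by clear * - hδ hd ht hℓ₁ hℓ₂ hfg ht₁ ht₂ ht₃; omega, by clear * - hμ hM; omega⟩
  obtain ⟨r14, r15, r17⟩ : ((t₁ + 2 * t) / 2 = M + t) ∧ (t₁ - M = M + μ) ∧ (t₂ / 2 = W) := ⟨by clear * - hμ hM; omega, by clear * - hμ hM; omega, by clear * - hν hW; omega⟩
  obtain ⟨r18, r19, r20⟩ : (t₃ / 2 = V) ∧ ((ℓ₂ + 1) / 2 = Gh) ∧ ((ℓ₁ + 1 - δ) / 2 = Yh) := ⟨by clear * - hκ hV; omega, by clear * - hγ hGh; omega, by clear * - hψ hYh hδ; omega⟩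
  obtain ⟨r21, r1, r2⟩ : ((2 * a + δ) / 2 = a) ∧ ((2 * e + δ) % 2 = δ) ∧ ((2 * e + δ) / 2 = e) := ⟨by clear * - hδ; omega, by clear * - hδ; omega, by clear * - hδ; omega⟩
  obtain ⟨r5, hne0, hne1⟩ : ((2 * (a + t) + δ - (2 * a + δ)) / 2 = t) ∧ (¬ (2 * (a + t) + δ = 2 * a + δ)) ∧ (¬ (2 * a + δ = 2 * (a + t) + δ)) :=
    ⟨by clear * - hδ; omega, by clear * - ht; omega, by clear * - ht; omega⟩
  obtain ⟨hlt', hnlt, hpar⟩ : (2 * a + δ < 2 * (a + t) + δ) ∧ (¬ (2 * (a + t) + δ < 2 * a + δ)) ∧ ((2 * (a + t) + δ - (2 * a + δ)) % 2 = 0) :=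
    ⟨by clear * - ht; omega, by clear * - ht; omega, by clear * - ht; omega⟩
  obtain ⟨r7, r8, rN0⟩ : ((2 * a + δ + 2 * δ + 2 - 3 * (2 * e + δ)) / 2 = a + 1 - 3 * e) ∧ ((2 * (a + t) + δ + 2 * δ + 2 - 3 * (2 * e + δ)) / 2 = a + t + 1 - 3 * e) ∧ (min (min (2 * a + δ) (2 * a + δ)) (min t₁ t₂) = t₁) :=
    ⟨by clear * - hδ; omega, by clear * - hδ; omega, by clear * - hδ hd ht hℓ₁ hℓ₂ hfg ht₁ ht₂ ht₃; omega⟩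
  obtain ⟨rN1, rN2⟩ : (min (min (2 * (a + t) + δ) (2 * a + δ)) (min (t₁ + 2 * t) (t₂ + 4 * t)) = 2 * a + δ) ∧ (min (min (2 * (a + t) + δ) (2 * a + δ)) (min t₁ t₂) = t₁) :=
    ⟨by clear * - hδ hd ht hℓ₁ hℓ₂ hfg ht₁ ht₂ ht₃; omega, by clear * - hδ hd ht hℓ₁ hℓ₂ hfg ht₁ ht₂ ht₃; omega⟩
  (try simp only [hne0]); (try simp only [hlt']); (try simp only [hnlt]); (try simp only [hpar])
  (try simp only [false_and]); (try simp only [and_self])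
  (try simp only [↓reduceIte]); (try simp only [Fin.isValue, Fin.reduceEq]); (try simp only [↓reduceIte]); (try simp only [zero_add]); (try simp only [add_zero]); (try simp only [r1])
  (try simp only [r2]); (try simp only [r5]); (try simp only [Matrix.cons_val_one])
  (try simp only [Matrix.cons_val_zero]); (try simp only [r7]); (try simp only [r9]); (try simp only [r10])
  (try simp only [r11]); (try simp only [r12]); (try simp only [r16]); (try simp only [r19]); (try simp only [r20])
  (try simp only [rN1]); (try simp only [r13]); (try simp only [r15]); (try simp only [r17])
  (try simp only [r18]); (try simp only [r21])
  clear r1 r2 r5 r7 r8 r9 r10 r11 r12 r13 r14 r15 r16 r17 r18 r19 r20 r21 rN0 rN1 rN2 hne0 hne1 hlt' hnlt hpar hl ha hlt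
  have hk' : k + e = 3 * a + t + δ + 1 := by clear * - hk; omega
  clear hk
  obtain ⟨cW, rfl⟩ : ∃ cW, W = M + cW := ⟨W - M, by clear * - hδ ht hℓ₁ hℓ₂ ht₁ ht₂ hμ hM hν hW; omega⟩
  obtain ⟨cV, rfl⟩ : ∃ cV, V = M + cV := ⟨V - M, by clear * - hδ hd ht hℓ₁ hfg ht₁ ht₃ hμ hM hκ hV; omega⟩
  simp only [Nat.add_sub_cancel_left]
  obtain ⟨hM', hcW, hcV⟩ : (2 * M + μ + ℓ₁ = 2 * a + δ) ∧ (cW + Gh = M + μ + ℓ₁) ∧ (cV + e = a + μ) :=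
    ⟨by clear * - hM ht₁; omega, by clear * - hM ht₁ hW ht₂ hGh hν hγ hℓ₂; omega, by clear * - hM ht₁ hV ht₃ hκ hμ hδ hfg; omega⟩
  have hYh' : 2 * Yh + δ = ℓ₁ + μ := by clear * - hM ht₁ hYh hψ hμ hδ hℓ₁; omega
  clear ht₁ ht₂ ht₃ hM hW hV hYh hν hκ hψ
  generalize hC : min (M + μ) (min cW cV) = C
  have hC3 := min3_linear (M + μ) cW cV
  rw [hC] at hC3
  obtain ⟨x₂, hx₂, hx₂eq⟩ : ∃ x₂ : ℕ, ((e ≤ Gh ∧ Gh = e + x₂) ∨ (Gh < e ∧ x₂ = 0)) ∧ Gh - e = x₂ := by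
    by_cases hGe : e ≤ Gh
    · exact ⟨Gh - e, Or.inl ⟨hGe, by omega⟩, rfl⟩
    · exact ⟨0, Or.inr ⟨by omega, rfl⟩, by omega⟩
  rw [hx₂eq]
  generalize hX : max ℓ₁ (x₂ + Yh) = X
  have hX2 := max_linear ℓ₁ (x₂ + Yh)
  rw [hX] at hX2
  clear hC hX hx₂eq
  obtain ⟨Bq, hB, hBeq⟩ : ∃ Bq : ℕ, ((3 * e ≤ a + 1 ∧ Bq + 3 * e = a + 1) ∨ (a + 1 < 3 * e ∧ Bq = 0)) ∧ a + 1 - 3 * e = Bq := by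
    by_cases h3 : 3 * e ≤ a + 1
    · exact ⟨a + 1 - 3 * e, Or.inl ⟨h3, by omega⟩, rfl⟩
    · exact ⟨0, Or.inr ⟨by omega, rfl⟩, by omega⟩
  rw [hBeq]
  clear hBeq
  generalize hP : max X (Bq + 2 * Yh) = P
  have hP2 := max_linear X (Bq + 2 * Yh)
  rw [hP] at hP2
  clear hP
  have htube : ¬ (a + (2 * e + δ) ≤ M) := by clear * - hM' hd hμ; omega
  rw [if_neg htube, max_eq_right (show 1 ≤ 2 * e + δ by clear * - hd; omega)]
  (try simp only [add_zero])
  by_cases hwin : 2 * e + δ ≤ C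
  · rw [if_pos hwin]
    exact leaf_T (by have h := lev_arith_top _ _ _ _ _ _ _ _ _ _ _ _ hδ hd hℓ₁ hμ hM' hcW hcV hYh' hk' _ hC3 _ hx₂ _ hX2; clear * - h; omega) (by have h := lev_arith_cross_bot _ _ _ _ _ _ _ _ _ _ _ _ hδ hd hℓ₁ hfg hμ hM' hcW hcV hYh' hk' _ hC3 _ hx₂ _ hX2 _ hB _ hP2 hwin; clear * - h; omega)
  · rw [if_neg hwin, mul_zero]
    exact leaf_Z (by have h := lev_arith_cross_empty _ _ _ _ _ _ _ _ _ _ _ _ _ _ hδ hd hℓ₁ hcorner hfg hμ hM' hcW hcV hγ hGh hYh' hk' _ hC3 _ hx₂ _ hX2 _ hB _ hP2 hwin; clear * - h; omega)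

/-- The lev tiling, strict apex `0` (glue legs `n₂`, apex `n₁`), slot `2`. [folklore] -/
theorem kappa_arith_lev_apex0_slot2 (x ω εH : ℚ) (εG : Fin 3 → Fin 3 → ℚ) {d n₂ n₁ k ℓ₁ ℓ₂ : ℕ} (hd : 2 ≤ d) (hlt : n₂ < n₁)
    (hl : n₂ % 2 = d % 2) (ha : n₁ % 2 = d % 2) (hk : 2 * k + d = n₁ + n₂ + n₂ + 2) (hfg : 2 * d ≤ n₂ + 1) (hfa : 2 * d ≤ n₁ + 1)
    (hℓ₁ : ℓ₁ ≤ 2) (hℓ₂ : ℓ₂ ≤ n₂ + ℓ₁) (hcorner : d % 2 = 0 → ℓ₁ = 1 → d + 1 ≤ ℓ₂) (i : Fin 3) (hi : i = 2) :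
    (if n₁ = n₂ ∧ n₂ = n₂ then εH * (if max 1 d ≤ min (n₁ - ℓ₁ - (n₁ - ℓ₁) / 2) (min ((2 * n₁ - ℓ₂) / 2 - (n₁ - ℓ₁) / 2) ((2 * n₁ - d + 1 - ℓ₁) / 2 - (n₁ - ℓ₁) / 2)) then
          x ^ (2 * ((n₁ - ℓ₁) / 2) + min (n₁ - ℓ₁ - (n₁ - ℓ₁) / 2) (min ((2 * n₁ - ℓ₂) / 2 - (n₁ - ℓ₁) / 2) ((2 * n₁ - d + 1 - ℓ₁) / 2 - (n₁ - ℓ₁) / 2)) + 1) - x ^ (2 * ((n₁ - ℓ₁) / 2) + max 1 d) else 0) else 0) +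
        ((if i = 0 then (if min (min n₂ n₂) (min (n₂ - ℓ₁) (2 * n₂ - ℓ₂)) / 2 + d ≤ (n₁ - ℓ₁) / 2 then
            ω * (x ^ ((n₁ - ℓ₁) / 2 + min (min n₂ n₂) (min (n₂ - ℓ₁) (2 * n₂ - ℓ₂)) / 2 + 1) - x ^ (2 * (min (min n₂ n₂) (min (n₂ - ℓ₁) (2 * n₂ - ℓ₂)) / 2) + d)) else 0) else 0) +
          (if n₂ = n₂ ∧ n₂ < n₁ ∧ (n₁ - n₂) % 2 = 0 then εG 0 i *
            (if max 1 (if i = 0 then d - (n₁ - n₂) / 2 else d) ≤ min (n₂ - ℓ₁ - (n₂ - ℓ₁) / 2) (min ((2 * n₂ - ℓ₂) / 2 - (n₂ - ℓ₁) / 2) ((2 * n₂ - d + 1 - ℓ₁) / 2 - (n₂ - ℓ₁) / 2)) then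
              x ^ (2 * ((n₂ - ℓ₁) / 2) + (n₁ - n₂) / 2 + min (n₂ - ℓ₁ - (n₂ - ℓ₁) / 2) (min ((2 * n₂ - ℓ₂) / 2 - (n₂ - ℓ₁) / 2) ((2 * n₂ - d + 1 - ℓ₁) / 2 - (n₂ - ℓ₁) / 2)) + 1) -
                x ^ (2 * ((n₂ - ℓ₁) / 2) + (n₁ - n₂) / 2 + max 1 (if i = 0 then d - (n₁ - n₂) / 2 else d)) else 0) else 0)) +
        ((if i = 1 then (if min (min n₁ n₂) (min (n₁ - ℓ₁) (2 * n₁ - ℓ₂)) / 2 + d ≤ (n₂ - ℓ₁) / 2 then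
            ω * (x ^ ((n₂ - ℓ₁) / 2 + min (min n₁ n₂) (min (n₁ - ℓ₁) (2 * n₁ - ℓ₂)) / 2 + 1) - x ^ (2 * (min (min n₁ n₂) (min (n₁ - ℓ₁) (2 * n₁ - ℓ₂)) / 2) + d)) else 0) else 0) +
          (if n₁ = n₂ ∧ n₁ < n₂ ∧ (n₂ - n₁) % 2 = 0 then εG 1 i *
            (if max 1 (if i = 1 then d - (n₂ - n₁) / 2 else d) ≤ min (n₁ - ℓ₁ - (n₁ - ℓ₁) / 2) (min ((2 * n₁ - ℓ₂) / 2 - (n₁ - ℓ₁) / 2) ((2 * n₁ - d + 1 - ℓ₁) / 2 - (n₁ - ℓ₁) / 2)) then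
              x ^ (2 * ((n₁ - ℓ₁) / 2) + (n₂ - n₁) / 2 + min (n₁ - ℓ₁ - (n₁ - ℓ₁) / 2) (min ((2 * n₁ - ℓ₂) / 2 - (n₁ - ℓ₁) / 2) ((2 * n₁ - d + 1 - ℓ₁) / 2 - (n₁ - ℓ₁) / 2)) + 1) -
                x ^ (2 * ((n₁ - ℓ₁) / 2) + (n₂ - n₁) / 2 + max 1 (if i = 1 then d - (n₂ - n₁) / 2 else d)) else 0) else 0)) +
        ((if i = 2 then (if min (min n₁ n₂) (min (n₂ - ℓ₁) (2 * n₂ - ℓ₂)) / 2 + d ≤ (n₂ - ℓ₁) / 2 then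
            ω * (x ^ ((n₂ - ℓ₁) / 2 + min (min n₁ n₂) (min (n₂ - ℓ₁) (2 * n₂ - ℓ₂)) / 2 + 1) - x ^ (2 * (min (min n₁ n₂) (min (n₂ - ℓ₁) (2 * n₂ - ℓ₂)) / 2) + d)) else 0) else 0) +
          (if n₁ = n₂ ∧ n₁ < n₂ ∧ (n₂ - n₁) % 2 = 0 then εG 2 i *
            (if max 1 (if i = 2 then d - (n₂ - n₁) / 2 else d) ≤ min (n₁ - ℓ₁ - (n₁ - ℓ₁) / 2) (min ((2 * n₁ - ℓ₂) / 2 - (n₁ - ℓ₁) / 2) ((2 * n₁ - d + 1 - ℓ₁) / 2 - (n₁ - ℓ₁) / 2)) then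
              x ^ (2 * ((n₁ - ℓ₁) / 2) + (n₂ - n₁) / 2 + min (n₁ - ℓ₁ - (n₁ - ℓ₁) / 2) (min ((2 * n₁ - ℓ₂) / 2 - (n₁ - ℓ₁) / 2) ((2 * n₁ - d + 1 - ℓ₁) / 2 - (n₁ - ℓ₁) / 2)) + 1) -
                x ^ (2 * ((n₁ - ℓ₁) / 2) + (n₂ - n₁) / 2 + max 1 (if i = 2 then d - (n₂ - n₁) / 2 else d)) else 0) else 0))
      = (if n₁ = n₂ ∧ n₂ = n₂ then εH else if n₂ = n₂ then εG 0 i else if n₁ = n₂ then εG 1 i else εG 2 i) *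
        (x ^ (k - max ℓ₁ ((ℓ₂ + 1) / 2 - d / 2 + (ℓ₁ + 1 - d % 2) / 2)) -
          x ^ (k - max (max ℓ₁ ((ℓ₂ + 1) / 2 - d / 2 + (ℓ₁ + 1 - d % 2) / 2))
            ((((![n₁, n₂, n₂] : Fin 3 → ℕ) i + 2 * (d % 2) + 2 - 3 * d) / 2) + 2 * ((ℓ₁ + 1 - d % 2) / 2)))) := by
  subst hi
  obtain ⟨δ, e, hδ, rfl⟩ : ∃ δ e, δ ≤ 1 ∧ d = 2 * e + δ := ⟨d % 2, d / 2, by omega, by omega⟩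
  obtain ⟨a, rfl⟩ : ∃ a, n₂ = 2 * a + δ := ⟨n₂ / 2, by omega⟩
  obtain ⟨t, ht, rfl⟩ : ∃ t, 1 ≤ t ∧ n₁ = 2 * (a + t) + δ := ⟨n₁ / 2 - a, by omega, by omega⟩
  obtain ⟨t₁, ht₁⟩ : ∃ t₁, 2 * a + δ = t₁ + ℓ₁ := ⟨2 * a + δ - ℓ₁, by omega⟩
  obtain ⟨t₂, ht₂⟩ : ∃ t₂, 2 * (2 * a + δ) = t₂ + ℓ₂ := ⟨2 * (2 * a + δ) - ℓ₂, by omega⟩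
  obtain ⟨t₃, ht₃⟩ : ∃ t₃, 2 * (2 * a + δ) + 1 = t₃ + (2 * e + δ) + ℓ₁ := ⟨2 * (2 * a + δ) + 1 - (2 * e + δ) - ℓ₁, by omega⟩
  obtain ⟨M, μ, hμ, hM⟩ : ∃ M μ, μ ≤ 1 ∧ t₁ = 2 * M + μ := ⟨t₁ / 2, t₁ % 2, by omega, by omega⟩
  obtain ⟨W, ν, hν, hW⟩ : ∃ W ν, ν ≤ 1 ∧ t₂ = 2 * W + ν := ⟨t₂ / 2, t₂ % 2, by omega, by omega⟩
  obtain ⟨V, κ, hκ, hV⟩ : ∃ V κ, κ ≤ 1 ∧ t₃ = 2 * V + κ := ⟨t₃ / 2, t₃ % 2, by omega, by omega⟩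
  obtain ⟨Gh, γ, hγ, hGh⟩ : ∃ Gh γ, γ ≤ 1 ∧ ℓ₂ + 1 = 2 * Gh + γ := ⟨(ℓ₂ + 1) / 2, (ℓ₂ + 1) % 2, by omega, by omega⟩
  obtain ⟨Yh, ψ, hψ, hYh⟩ : ∃ Yh ψ, ψ ≤ 1 ∧ ℓ₁ + 1 = 2 * Yh + ψ + δ := ⟨(ℓ₁ + 1 - δ) / 2, (ℓ₁ + 1 - δ) % 2, by omega, by omega⟩
  obtain ⟨r9, r10, r11⟩ : (2 * a + δ - ℓ₁ = t₁) ∧ (2 * (2 * a + δ) - ℓ₂ = t₂) ∧ (2 * (2 * a + δ) - (2 * e + δ) + 1 - ℓ₁ = t₃) :=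
    ⟨by clear * - hδ hd ht hℓ₁ hℓ₂ hfg ht₁ ht₂ ht₃; omega, by clear * - hδ hd ht hℓ₁ hℓ₂ hfg ht₁ ht₂ ht₃; omega, by clear * - hδ hd ht hℓ₁ hℓ₂ hfg ht₁ ht₂ ht₃; omega⟩
  obtain ⟨r12, r16, r13⟩ : (2 * (a + t) + δ - ℓ₁ = t₁ + 2 * t) ∧ (2 * (2 * (a + t) + δ) - ℓ₂ = t₂ + 4 * t) ∧ (t₁ / 2 = M) :=
    ⟨by clear * - hδ hd ht hℓ₁ hℓ₂ hfg ht₁ ht₂ ht₃; omega, by clear * - hδ hd ht hℓ₁ hℓ₂ hfg ht₁ ht₂ ht₃; omega, by clear * - hμ hM; omega⟩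
  obtain ⟨r14, r15, r17⟩ : ((t₁ + 2 * t) / 2 = M + t) ∧ (t₁ - M = M + μ) ∧ (t₂ / 2 = W) := ⟨by clear * - hμ hM; omega, by clear * - hμ hM; omega, by clear * - hν hW; omega⟩
  obtain ⟨r18, r19, r20⟩ : (t₃ / 2 = V) ∧ ((ℓ₂ + 1) / 2 = Gh) ∧ ((ℓ₁ + 1 - δ) / 2 = Yh) := ⟨by clear * - hκ hV; omega, by clear * - hγ hGh; omega, by clear * - hψ hYh hδ; omega⟩
  obtain ⟨r21, r1, r2⟩ : ((2 * a + δ) / 2 = a) ∧ ((2 * e + δ) % 2 = δ) ∧ ((2 * e + δ) / 2 = e) := ⟨by clear * - hδ; omega, by clear * - hδ; omega, by clear * - hδ; omega⟩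
  obtain ⟨r5, hne0, hne1⟩ : ((2 * (a + t) + δ - (2 * a + δ)) / 2 = t) ∧ (¬ (2 * (a + t) + δ = 2 * a + δ)) ∧ (¬ (2 * a + δ = 2 * (a + t) + δ)) :=
    ⟨by clear * - hδ; omega, by clear * - ht; omega, by clear * - ht; omega⟩
  obtain ⟨hlt', hnlt, hpar⟩ : (2 * a + δ < 2 * (a + t) + δ) ∧ (¬ (2 * (a + t) + δ < 2 * a + δ)) ∧ ((2 * (a + t) + δ - (2 * a + δ)) % 2 = 0) :=
    ⟨by clear * - ht; omega, by clear * - ht; omega, by clear * - ht; omega⟩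
  obtain ⟨r7, r8, rN0⟩ : ((2 * a + δ + 2 * δ + 2 - 3 * (2 * e + δ)) / 2 = a + 1 - 3 * e) ∧ ((2 * (a + t) + δ + 2 * δ + 2 - 3 * (2 * e + δ)) / 2 = a + t + 1 - 3 * e) ∧ (min (min (2 * a + δ) (2 * a + δ)) (min t₁ t₂) = t₁) :=
    ⟨by clear * - hδ; omega, by clear * - hδ; omega, by clear * - hδ hd ht hℓ₁ hℓ₂ hfg ht₁ ht₂ ht₃; omega⟩
  obtain ⟨rN1, rN2⟩ : (min (min (2 * (a + t) + δ) (2 * a + δ)) (min (t₁ + 2 * t) (t₂ + 4 * t)) = 2 * a + δ) ∧ (min (min (2 * (a + t) + δ) (2 * a + δ)) (min t₁ t₂) = t₁) :=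
    ⟨by clear * - hδ hd ht hℓ₁ hℓ₂ hfg ht₁ ht₂ ht₃; omega, by clear * - hδ hd ht hℓ₁ hℓ₂ hfg ht₁ ht₂ ht₃; omega⟩
  (try simp only [hne0]); (try simp only [hlt']); (try simp only [hnlt]); (try simp only [hpar])
  (try simp only [false_and]); (try simp only [and_self])
  (try simp only [↓reduceIte]); (try simp only [Fin.isValue, Fin.reduceEq]); (try simp only [↓reduceIte]); (try simp only [zero_add]); (try simp only [add_zero]); (try simp only [r1])
  (try simp only [r2]); (try simp only [r5]); (try simp only [Matrix.cons_val_two]); (try simp only [Matrix.tail_cons]); (try simp only [Matrix.head_cons])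
  (try simp only [r7]); (try simp only [r9]); (try simp only [r10])
  (try simp only [r11]); (try simp only [r19]); (try simp only [r20])
  (try simp only [rN2]); (try simp only [r13]); (try simp only [r15]); (try simp only [r17])
  (try simp only [r18])
  clear r1 r2 r5 r7 r8 r9 r10 r11 r12 r13 r14 r15 r16 r17 r18 r19 r20 r21 rN0 rN1 rN2 hne0 hne1 hlt' hnlt hpar hl ha hlt
  have hk' : k + e = 3 * a + t + δ + 1 := by clear * - hk; omega
  clear hk
  obtain ⟨cW, rfl⟩ : ∃ cW, W = M + cW := ⟨W - M, by clear * - hδ ht hℓ₁ hℓ₂ ht₁ ht₂ hμ hM hν hW; omega⟩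
  obtain ⟨cV, rfl⟩ : ∃ cV, V = M + cV := ⟨V - M, by clear * - hδ hd ht hℓ₁ hfg ht₁ ht₃ hμ hM hκ hV; omega⟩
  simp only [Nat.add_sub_cancel_left]
  obtain ⟨hM', hcW, hcV⟩ : (2 * M + μ + ℓ₁ = 2 * a + δ) ∧ (cW + Gh = M + μ + ℓ₁) ∧ (cV + e = a + μ) :=
    ⟨by clear * - hM ht₁; omega, by clear * - hM ht₁ hW ht₂ hGh hν hγ hℓ₂; omega, by clear * - hM ht₁ hV ht₃ hκ hμ hδ hfg; omega⟩
  have hYh' : 2 * Yh + δ = ℓ₁ + μ := by clear * - hM ht₁ hYh hψ hμ hδ hℓ₁; omega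
  clear ht₁ ht₂ ht₃ hM hW hV hYh hν hκ hψ
  generalize hC : min (M + μ) (min cW cV) = C
  have hC3 := min3_linear (M + μ) cW cV
  rw [hC] at hC3
  obtain ⟨x₂, hx₂, hx₂eq⟩ : ∃ x₂ : ℕ, ((e ≤ Gh ∧ Gh = e + x₂) ∨ (Gh < e ∧ x₂ = 0)) ∧ Gh - e = x₂ := by
    by_cases hGe : e ≤ Gh
    · exact ⟨Gh - e, Or.inl ⟨hGe, by omega⟩, rfl⟩
    · exact ⟨0, Or.inr ⟨by omega, rfl⟩, by omega⟩
  rw [hx₂eq]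
  generalize hX : max ℓ₁ (x₂ + Yh) = X
  have hX2 := max_linear ℓ₁ (x₂ + Yh)
  rw [hX] at hX2
  clear hC hX hx₂eq
  obtain ⟨Bq, hB, hBeq⟩ : ∃ Bq : ℕ, ((3 * e ≤ a + 1 ∧ Bq + 3 * e = a + 1) ∨ (a + 1 < 3 * e ∧ Bq = 0)) ∧ a + 1 - 3 * e = Bq := by
    by_cases h3 : 3 * e ≤ a + 1
    · exact ⟨a + 1 - 3 * e, Or.inl ⟨h3, by omega⟩, rfl⟩
    · exact ⟨0, Or.inr ⟨by omega, rfl⟩, by omega⟩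
  rw [hBeq]
  clear hBeq
  generalize hP : max X (Bq + 2 * Yh) = P
  have hP2 := max_linear X (Bq + 2 * Yh)
  rw [hP] at hP2
  clear hP
  have htube : ¬ (M + (2 * e + δ) ≤ M) := by clear * - hM' hd hμ; omega
  rw [if_neg htube, max_eq_right (show 1 ≤ 2 * e + δ by clear * - hd; omega)]
  (try simp only [add_zero])
  by_cases hwin : 2 * e + δ ≤ C
  · rw [if_pos hwin]
    exact leaf_T (by have h := lev_arith_top _ _ _ _ _ _ _ _ _ _ _ _ hδ hd hℓ₁ hμ hM' hcW hcV hYh' hk' _ hC3 _ hx₂ _ hX2; clear * - h; omega) (by have h := lev_arith_cross_bot _ _ _ _ _ _ _ _ _ _ _ _ hδ hd hℓ₁ hfg hμ hM' hcW hcV hYh' hk' _ hC3 _ hx₂ _ hX2 _ hB _ hP2 hwin; clear * - h; omega)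
  · rw [if_neg hwin, mul_zero]
    exact leaf_Z (by have h := lev_arith_cross_empty _ _ _ _ _ _ _ _ _ _ _ _ _ _ hδ hd hℓ₁ hcorner hfg hμ hM' hcW hcV hγ hGh hYh' hk' _ hC3 _ hx₂ _ hX2 _ hB _ hP2 hwin; clear * - h; omega)

end Summit.HodgeConjecture.HodgeConjecture.Cruxes.H413.F0P3cDyRamLevBoxSumTiling
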